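import Summits.QuantumFields.BalabanUV.T4Continuum.Support.B13StepOfRecordSecantEnd
import Summits.QuantumFields.BalabanUV.T4Continuum.Support.B13StepOfRecordReadAt

/-!
# NE5 ∕ U3 — the SECANT END faces ON BAŁABAN's CARRIERS OF RECORD with ONE constant for EVERY PAIR OF RUNS (η-uniform form)
# and the leaf-L10 letters `k₀`, `B`, `E₁` eliminated (row O6-n follower of `B13StepSecantEnd` ∕ `B13StepOfRecordSecantEnd`)

Cell `pub-balaban`, unit `b2b-balaban-t4-ne5-formalise-leaf-10` (NE5 formalisation swarm, LEAF PROVER 10, gen 4; journal INTENT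
l.7715, leaf-01-g3's «GO» l.8066, typer ruling l.8262 «the UNIFORM secant face only»).  Summits-side NEW WORK under the LEAN
PLACEMENT RULE (cell bookkeeping; NOT a Literature module; NO owner END-face module is edited — a NEW module applying the landed
secant END faces `B13StepSecantEnd.ne5_of_assembly_secant` (leaf-03-g2, p210428) and
`B13StepOfRecordSecantEnd.ne5_of_record_secant_actNormDecay` (leaf-01-g3, p211635) BY NAME).  HONEST FRAMING: rung (B)+1 of the
FINITE-VOLUME T⁴ continuum programme — NOT infinite volume, NOT a mass gap, NOT the Clay problem, and **NOT A PROOF OF NE5**: each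
face below is an IMPLICATION whose analytic binders (the transport reading; the one-run slice budgets — W3 KIND; the one-run levels
L05∕L06 — quoted SHAPES of [Balaban1987RG1] (0.25) p. 257 ∕ (1.18) p. 263; W1 in row NE2's entry currency; W4; W2-op =
`OpLipschitz`, cell GAPS G-ne5p1-1′, NOT PRINTED; the per-activity structure ∕ exponent bounds ∕ absolute majorants of the
(2.14)-terms — (2.14)∕(2.15)∕(2.38), (2.18)∕(2.20), (1.26)∕(2.41) KIND, NOT PRINTED as class statements; the radii) are DISPLAYED
HYPOTHESES, asserted nowhere.  HONEST DEPENDENCY (cell line, verbatim): continuum YM on T⁴ ⇐ BetaPertH ∧ nine spine estimates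
(0/9 proved); BetaPertH ⇐ (D1) ∧ (D4) ∧ CAP+tail; G-an2-4 gates asym, D1 and NE2/3/4.

WHAT THIS FILE DOES.  In the secant END (`T4InputCauchyRateSecant.ne5_at_of_stepModel_secant_scale_nat`, owner lineage) the reach
`ρ₀` is TIED to the analytic binder `OpLipschitz … Λop ρ₀` and the smallness `ω + 2G₁·cA < θ′` carries no auxiliary letter; the
only eliminable letters are the reach scale `k₀` (`(c₁∕r₀)·θ^{k₀} ≤ ρ₀`), the first-scales constant `B` and the free reference
level `E₁` — from `0 < θ < 1`, `0 < ρ₀` (`secant_letters_exists`, §1; `OutputRateArithmetic.reach_scale_exists` ∕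
`OutputRateResidual.first_scales_const` BY NAME).  The point of this file is the QUANTIFIER ORDER: the constant produced by the
secant END depends on the displayed SIZES only — never on the pair of runs `R : B13Carriers.TwoRuns 𝔾` (i.e. on the two lattice
spacings), the slot package `S`, the window `W`, the class radii or the activity data — so ONE `C₅` serves them all:
* §2 **`uniform_ne5_of_record_secant`** — E8's binder list (`B13StepSecantEnd.ne5_of_assembly_secant` at the assembly of record
  `B13StepOfRecord.assembly S`; d3's convergence `hconv` and the per-domain first-moment budget `hmom` DISPLAYED, `G₁` a size):
  `∃ C₅, ∀ R S W ROp RHist N A Dt, S.D.ω = ω → ⋯ → NE5 (outA S E₀ cB) (outB S E₀ cB) W κ θ′ C₅`;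
* §3 **`uniform_ne5_of_record_secant_actNormDecay`** — N74's binder list (`B13StepOfRecordSecantEnd.ne5_of_record_secant_actNormDecay`:
  the history half of W2 at ACTIVITY LEVEL — structure `ActExpLinearOn` of `S.act`, exponent bounds `0 ≤ N ≤ N̄`, absolute
  majorants with decay split and anchored exponential norm `Φ′`, `36Φ′ < 1`; geometry by P2's theorems inside):
  `∃ C₅, ∀ R S W ROp RHist N A A′ Dt, S.D.ω = ω → ⋯ → NE5 (outA S E₀ cB) (outB S E₀ cB) W κ θ′ C₅` from the sizes
  `κ, Λop, N̄, Φ′, EA₀, E₀, cA, cB, c₁, r₀, δ′, θ, θ′, ω, ρ₀` with `ω + 2·(N̄·Φ′∕(1 − 36Φ′)²)·cA < θ′`.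
The per-pair `∃ C₅` face on the carriers of record is leaf-01-g3's `exists_ne5_of_record_secant_actNormDecay` (NOT restated here).
Nothing is asserted about [II]'s kernels ∕ potentials ∕ terms (the `Slots` stay PARAMETERS); 0 sorry; axioms ⊆ {propext,
Classical.choice, Quot.sound}.
-/

noncomputable section

open scoped BigOperators
open Metric Set

namespace Summit.QuantumFields.BalabanUV.T4Continuum.B13StepSecantArithmetic

open Literature.MathematicalPhysics.QuantumFieldTheory.Balaban1983to89
open Literature.MathematicalPhysics.QuantumFieldTheory.Balaban1983to89.T4OutputRate (Carriers Functional DecayBound NE5)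
open Literature.MathematicalPhysics.QuantumFieldTheory.Balaban1983to89.T4InputCauchyRateData (StepModel)
open Literature.MathematicalPhysics.QuantumFieldTheory.Balaban1983to89.T4InputCauchyRateSpecies (ballClass OpLipschitz)
open Summit.QuantumFields.BalabanUV.T4Continuum.B13Carriers (TwoRuns)
open Summit.QuantumFields.BalabanUV.T4Continuum.B13OpDatum (OpDatum)
open Summit.QuantumFields.BalabanUV.T4Continuum.B13OpDatumJunctions (RawBounded WeightedEntrywiseRate)
open Summit.QuantumFields.BalabanUV.T4Continuum.B13StepTermLabels (TermIdx InnerLabel)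
open Summit.QuantumFields.BalabanUV.T4Continuum.B13StepTermFamily (ActData ActExpLinearOn)
open Summit.QuantumFields.BalabanUV.T4Continuum.B13StepTermSocket (labelsIndexing touchInc)
open Summit.QuantumFields.BalabanUV.T4Continuum.B13InnerData (Bnd b13InnerData)
open Summit.QuantumFields.BalabanUV.T4Continuum.B13ActMajorantLevels (polyWeight)
open Summit.QuantumFields.BalabanUV.T4Continuum.UrsellTreeSum (ind)
open Summit.QuantumFields.BalabanUV.T4Continuum.B13TermRep (actMajorant)
open Summit.QuantumFields.BalabanUV.T4Continuum.B13Base (selfCtr)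
open Summit.QuantumFields.BalabanUV.T4Continuum.B13Represents (Assembly)
open Summit.QuantumFields.BalabanUV.T4Continuum.B13TermHistSecant (ActExpNormBound ActAbsBound secMajorant)
open Summit.QuantumFields.BalabanUV.T4Continuum.B13StepSecantEnd (ne5_of_assembly_secant)
open Summit.QuantumFields.BalabanUV.T4Continuum.B13StepOfRecordSecantEnd (ne5_of_record_secant_actNormDecay)
open Summit.QuantumFields.BalabanUV.T4Continuum.B13DomainGeometryTR (SCube footprint domainGeometry)
open Summit.QuantumFields.BalabanUV.T4Continuum.B13StepOfRecord (Slots assembly step outA outB)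
open Summit.QuantumFields.BalabanUV.T4Continuum.OutputRateArithmetic (reach_scale_exists)

/-! ## §1 The secant END's eliminable letters: the operator reach scale `k₀` and the first-scales constant `B` -/

/-- [folklore] The secant END's two leaf-L10 letters at once: from `0 ≤ D`, `0 < θ < 1` and `0 < ρ₀`, a reach scale `k₀` with
`D·θ^{k₀} ≤ ρ₀` and a first-scales constant `B ≥ 0` with `EA₀ + E₀ ≤ B·θ^k` for `k < k₀` (`OutputRateArithmetic.reach_scale_exists`
at fed-back level `0`, `OutputRateResidual.first_scales_const` with `B = max 0 ((EA₀ + E₀)∕θ^{k₀})`).  Both depend on `D, θ, ρ₀,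
EA₀, E₀` only. -/
theorem secant_letters_exists {D θ ρ₀ EA₀ E₀ : ℝ} (hD : 0 ≤ D) (hθ0 : 0 < θ) (hθ1 : θ < 1) (hρ₀ : 0 < ρ₀) :
    ∃ k₀ : ℕ, ∃ B : ℝ, 0 ≤ B ∧ D * θ ^ k₀ ≤ ρ₀ ∧ ∀ k < k₀, EA₀ + E₀ ≤ B * θ ^ k := by
  obtain ⟨k₀, hk₀⟩ := reach_scale_exists (h := 0) hD hθ1 hρ₀
  exact ⟨k₀, max 0 ((EA₀ + E₀) / θ ^ k₀), le_max_left _ _, by simpa using hk₀,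
    fun k hk => OutputRateResidual.first_scales_const hθ0 hθ1.le hk.le⟩

/-! ## §2 E8 on the carriers of record: one constant for every pair of runs -/

/-- [folklore] **THE SECANT END (E8) ON THE CARRIERS OF RECORD WITH A CONSTANT UNIFORM IN THE PAIR OF RUNS.**  Fix the displayed
SIZES — decay rate `κ` (no sign needed here), operator modulus `Λop`, history first-moment budget `G₁ ≥ 0`, one-run levels `EA₀, E₀`, slice
constants `cA, cB`, row NE2's entry constant `c₁` and margin floor `r₀`, W4's `δ′`, input rate `0 < θ < 1`, target rate
`θ ≤ θ′ ≤ 1`, age damping `0 < ω < 1`, operator reach `0 < ρ₀` — subject to the ONE strict size inequality `ω + 2G₁·cA < θ′`.  Then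
ONE constant `C₅` serves EVERY pair of runs `R : B13Carriers.TwoRuns 𝔾` (every pair of lattice spacings), every slot package
`S : B13StepOfRecord.Slots R E IOp Hist` with `S.D.ω = ω`, every window `W`, class radii `ROp, RHist` and activity data `N, A, Dt`:
the displayed binders of leaf-03's `B13StepSecantEnd.ne5_of_assembly_secant` at `B13StepOfRecord.assembly S` (transport reading;
the two one-run slice budgets; `DecayBound (outA S E₀ cB) W EA₀ κ` ∕ `DecayBound (outB S E₀ cB) W E₀ κ`; `RawBounded` ×2 +
`WeightedEntrywiseRate … c₁ θ^k` + floor `r₀`; `InsertionRate W κ E₀ δ′ θ`; `OpLipschitz … κ Λop ρ₀`; structure `ActExpLinearOn` of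
`S.act` with exponent bounds `N ≥ 0`, absolute majorants `A`, d3's convergence and the per-domain first-moment budget `G₁` on
`ballClass (selfCtr raw histRef) ROp RHist`; the three radii conditions) IMPLY `NE5 (outA S E₀ cB) (outB S E₀ cB) W κ θ′ C₅`.
The η-uniformity is the quantifier order `∃ C₅, ∀ R S W …`.  NOT a proof of NE5: an implication from displayed binders. -/
theorem uniform_ne5_of_record_secant {κ Λop G₁ EA₀ E₀ cA cB c₁ r₀ δ' θ θ' ω ρ₀ : ℝ}
    (hEA₀ : 0 ≤ EA₀) (hE₀ : 0 ≤ E₀) (hΛop : 0 ≤ Λop) (hG₁ : 0 ≤ G₁) (hcA : 0 ≤ cA) (hcB : 0 ≤ cB) (hc₁ : 0 ≤ c₁) (hr₀ : 0 < r₀)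
    (hδ' : 0 ≤ δ') (hθ0 : 0 < θ) (hθ1 : θ < 1) (hθθ' : θ ≤ θ') (hθ'1 : θ' ≤ 1) (hω : 0 < ω) (hω1 : ω < 1) (hρ₀ : 0 < ρ₀)
    (hsmall : ω + 2 * G₁ * cA < θ') :
    ∃ C₅ : ℝ, ∀ {𝔾 : Type} [GaugeGroup 𝔾] {R : TwoRuns 𝔾} {E IOp Hist Ω : Type*} [NormedAddCommGroup Hist] [NormedSpace ℂ Hist]
      [MeasurableSpace Ω] (S : Slots R E IOp Hist) {W : Set (ℕ → ℝ)} {ROp RHist : ℕ → ℝ}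
      {N A : ℕ → (ℕ → ℝ) → R.carriers.BgB → R.carriers.Dom → InnerLabel R.carriers.Dom (Bnd R) → ℝ}
      {Dt : ActData R.carriers.Dom (InnerLabel R.carriers.Dom (Bnd R)) (OpDatum E) Hist Ω},
      S.D.ω = ω →
      (assembly S).TransportReads W →
      (assembly S).SliceBudgetB W κ cB → S.D.SliceBudget (step S E₀ cB) W κ cA →
      DecayBound (outA S E₀ cB) W EA₀ κ → DecayBound (outB S E₀ cB) W E₀ κ →
      RawBounded S.F (assembly S).rawAt W → RawBounded S.F S.rawB W →
      WeightedEntrywiseRate S.F (assembly S).rawAt S.rawB W c₁ (fun k => θ ^ k) → (∀ k, r₀ ≤ S.rOp k) →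
      (step S E₀ cB).InsertionRate W κ E₀ δ' θ →
      OpLipschitz (step S E₀ cB) W κ Λop ρ₀ →
      ActExpLinearOn (assembly S).𝒯 S.act Dt (ballClass (selfCtr (assembly S).raw (assembly S).histRef) ROp RHist) W →
      ActExpNormBound (assembly S).𝒯 Dt (ballClass (selfCtr (assembly S).raw (assembly S).histRef) ROp RHist) W S.rHist N →
      (∀ k g U Z j, 0 ≤ N k g U Z j) →
      ActAbsBound (assembly S).𝒯 Dt (ballClass (selfCtr (assembly S).raw (assembly S).histRef) ROp RHist) W A →
      (∀ k, ∀ g ∈ W, ∀ (U : R.carriers.BgB) (X : R.carriers.Dom), R.carriers.scale X = k →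
        Summable (actMajorant (assembly S).𝒯 (assembly S).inc (A k g U) k X)) →
      (∀ k, ∀ g ∈ W, ∀ (U : R.carriers.BgB) (X : R.carriers.Dom), R.carriers.scale X = k →
        Summable (secMajorant (assembly S).𝒯 (assembly S).inc (N k g U) (A k g U) k X) ∧
          ∑' i, secMajorant (assembly S).𝒯 (assembly S).inc (N k g U) (A k g U) k X i ≤ G₁ * Real.exp (-(κ * R.carriers.d X))) →
      (∀ k, c₁ / r₀ * S.rOp k ≤ ROp k) → (∀ k, (assembly S).bHist E₀ cB k ≤ RHist k) →
      (∀ k, δ' * S.rHist k + EA₀ * (S.rHist k * (cA / (1 - S.D.ω))) ≤ RHist k) →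
      NE5 (outA S E₀ cB) (outB S E₀ cB) W κ θ' C₅ := by
  obtain ⟨k₀, B, hB, hreach, hfirst⟩ :=
    secant_letters_exists (EA₀ := EA₀) (E₀ := E₀) (div_nonneg hc₁ hr₀.le) hθ0 hθ1 hρ₀
  refine ⟨(Λop * (c₁ / r₀) + 2 * G₁ * δ' + B) * (θ' - ω) / (θ' - (ω + 2 * G₁ * cA)), ?_⟩
  intro 𝔾 _ R E IOp Hist Ω _ _ _ S W ROp RHist N A Dt hSω hT hbB hbA hdA hdB hRA hRB hwer hfl hins hopL hexp hN hN0 habs hconv hmom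
    hOp hHist hHistA
  subst hSω
  exact ne5_of_assembly_secant (assembly S) hT hbB hbA hdA hdB hRA hRB hwer hfl hins hopL hexp hN hN0 habs hconv hmom hOp hHist
    hHistA hEA₀ hE₀ one_pos hΛop hG₁ hcA hcB hc₁ hr₀ hδ' hθ0.le hθθ' hθ'1 hω hω1 hreach hB hfirst hsmall

/-! ## §3 N74 on the carriers of record: one constant for every pair of runs, history half of W2 at activity level -/

/-- [folklore] **THE SECANT END ON THE CARRIERS OF RECORD, HISTORY HALF AT ACTIVITY LEVEL, WITH A CONSTANT UNIFORM IN THE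
PAIR OF RUNS.**  Fix the displayed SIZES — decay rate `κ ≥ 0`, operator modulus `Λop` and reach `ρ₀ > 0`, the exponent ceiling
`N̄ ≥ 0`, the anchored exponential norm `Φ′ ≥ 0` with `36Φ′ < 1`, one-run levels `EA₀, E₀`, slice constants `cA, cB`, row NE2's
entry constant `c₁` and margin floor `r₀`, W4's `δ′`, input rate `0 < θ < 1`, target rate `θ ≤ θ′ ≤ 1`, age damping
`0 < ω < 1` — subject to the ONE strict size inequality `ω + 2·(N̄·Φ′∕(1 − 36Φ′)²)·cA < θ′`.  Then ONE constant `C₅` serves EVERY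
pair of runs `R : B13Carriers.TwoRuns 𝔾` (every pair of lattice spacings), every slot package `S : B13StepOfRecord.Slots R E IOp Hist`
with `S.D.ω = ω`, every window `W`, class radii `ROp, RHist`, exponents `N`, majorants `A, A′` and activity data `Dt`: the displayed
binders of leaf-01's `B13StepOfRecordSecantEnd.ne5_of_record_secant_actNormDecay` (transport reading; the two one-run slice budgets;
`DecayBound (outA S E₀ cB) W EA₀ κ` ∕ `DecayBound (outB S E₀ cB) W E₀ κ`; `RawBounded` ×2 + `WeightedEntrywiseRate … c₁ θ^k` +
floor `r₀`; `InsertionRate W κ E₀ δ′ θ`; `OpLipschitz … κ Λop ρ₀`; structure `ActExpLinearOn` of `S.act` on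
`ballClass (selfCtr raw histRef) ROp RHist` with exponent bounds `0 ≤ N ≤ N̄` in units `S.rHist`, absolute majorants `A` with decay
split `A ≤ A′·e^{−κ(d(Z)+5)}` and anchored exponential norm `Φ′` of `A′` on every `R.domAt k`; the three radii conditions) IMPLY
`NE5 (outA S E₀ cB) (outB S E₀ cB) W κ θ′ C₅`; footprint locality, reach (ν = 9) and (2.27) (c = 5) are THEOREMS on the carriers of
record inside leaf-01's face.  The η-uniformity is the quantifier order `∃ C₅, ∀ R S W …`.  NOT a proof of NE5: an implication
from displayed binders. -/
theorem uniform_ne5_of_record_secant_actNormDecay {κ Λop Nbar Φ' EA₀ E₀ cA cB c₁ r₀ δ' θ θ' ω ρ₀ : ℝ}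
    (hκ : 0 ≤ κ) (hEA₀ : 0 ≤ EA₀) (hE₀ : 0 ≤ E₀) (hΛop : 0 ≤ Λop) (hNbar : 0 ≤ Nbar) (hΦ0 : 0 ≤ Φ') (hΦsmall : 36 * Φ' < 1)
    (hcA : 0 ≤ cA) (hcB : 0 ≤ cB) (hc₁ : 0 ≤ c₁) (hr₀ : 0 < r₀) (hδ' : 0 ≤ δ') (hθ0 : 0 < θ) (hθ1 : θ < 1) (hθθ' : θ ≤ θ')
    (hθ'1 : θ' ≤ 1) (hω : 0 < ω) (hω1 : ω < 1) (hρ₀ : 0 < ρ₀)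
    (hsmall : ω + 2 * (Nbar * (Φ' / (1 - 36 * Φ') ^ 2)) * cA < θ') :
    ∃ C₅ : ℝ, ∀ {𝔾 : Type} [GaugeGroup 𝔾] {R : TwoRuns 𝔾} {E IOp Hist Ω : Type*} [NormedAddCommGroup Hist] [NormedSpace ℂ Hist]
      [MeasurableSpace Ω] (S : Slots R E IOp Hist) {W : Set (ℕ → ℝ)} {ROp RHist : ℕ → ℝ}
      {N A A' : ℕ → (ℕ → ℝ) → R.carriers.BgB → R.carriers.Dom → InnerLabel R.carriers.Dom (Bnd R) → ℝ}
      {Dt : ActData R.carriers.Dom (InnerLabel R.carriers.Dom (Bnd R)) (OpDatum E) Hist Ω},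
      S.D.ω = ω →
      (assembly S).TransportReads W →
      (assembly S).SliceBudgetB W κ cB → S.D.SliceBudget (step S E₀ cB) W κ cA →
      DecayBound (outA S E₀ cB) W EA₀ κ → DecayBound (outB S E₀ cB) W E₀ κ →
      RawBounded S.F (assembly S).rawAt W → RawBounded S.F S.rawB W →
      WeightedEntrywiseRate S.F (assembly S).rawAt S.rawB W c₁ (fun k => θ ^ k) → (∀ k, r₀ ≤ S.rOp k) →
      (step S E₀ cB).InsertionRate W κ E₀ δ' θ →
      OpLipschitz (step S E₀ cB) W κ Λop ρ₀ →
      ActExpLinearOn (labelsIndexing (domainGeometry R) (b13InnerData R)) S.act Dt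
        (ballClass (selfCtr (assembly S).raw (assembly S).histRef) ROp RHist) W →
      ActExpNormBound (labelsIndexing (domainGeometry R) (b13InnerData R)) Dt
        (ballClass (selfCtr (assembly S).raw (assembly S).histRef) ROp RHist) W S.rHist N →
      (∀ k g U Z ℓ, 0 ≤ N k g U Z ℓ) → (∀ k g U Z ℓ, N k g U Z ℓ ≤ Nbar) →
      ActAbsBound (labelsIndexing (domainGeometry R) (b13InnerData R)) Dt
        (ballClass (selfCtr (assembly S).raw (assembly S).histRef) ROp RHist) W A →
      (∀ k g U Z ℓ, 0 ≤ A k g U Z ℓ) → (∀ k g U Z ℓ, 0 ≤ A' k g U Z ℓ) →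
      (∀ k g U Z ℓ, A k g U Z ℓ ≤ A' k g U Z ℓ * Real.exp (-(κ * (R.carriers.d Z + 5)))) →
      (∀ k, ∀ g ∈ W, ∀ (U : R.carriers.BgB) (q : SCube R),
        ∑ Z ∈ R.domAt k, ind (q ∈ footprint Z) * polyWeight (b13InnerData R) (A' k g U) k Z *
          Real.exp ((footprint Z).card) ≤ Φ') →
      (∀ k, c₁ / r₀ * S.rOp k ≤ ROp k) → (∀ k, (assembly S).bHist E₀ cB k ≤ RHist k) →
      (∀ k, δ' * S.rHist k + EA₀ * (S.rHist k * (cA / (1 - S.D.ω))) ≤ RHist k) →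
      NE5 (outA S E₀ cB) (outB S E₀ cB) W κ θ' C₅ := by
  obtain ⟨k₀, B, hB, hreach, hfirst⟩ :=
    secant_letters_exists (EA₀ := EA₀) (E₀ := E₀) (div_nonneg hc₁ hr₀.le) hθ0 hθ1 hρ₀
  refine ⟨(Λop * (c₁ / r₀) + 2 * (Nbar * (Φ' / (1 - 36 * Φ') ^ 2)) * δ' + B) * (θ' - ω) /
    (θ' - (ω + 2 * (Nbar * (Φ' / (1 - 36 * Φ') ^ 2)) * cA)), ?_⟩
  intro 𝔾 _ R E IOp Hist Ω _ _ _ S W ROp RHist N A A' Dt hSω hT hbB hbA hdA hdB hRA hRB hwer hfl hins hopL hexp hN hN0 hNle habs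
    hA0 hA0' hdec hΦ hOp hHist hHistA
  subst hSω
  exact ne5_of_record_secant_actNormDecay S E₀ cB hT hbB hbA hdA hdB hRA hRB hwer hfl hins hopL hexp hN hN0 hNle hNbar habs hA0
    hA0' hκ hdec hΦ0 hΦsmall hΦ hOp hHist hHistA hEA₀ hE₀ one_pos hΛop hcA hcB hc₁ hr₀ hδ' hθ0.le hθθ' hθ'1 hω hω1 hreach hB
    hfirst hsmall

/-! ## §4 (v1.1 append) The same two uniform faces with the transport READING DISCHARGED — slot packages READ AT TRANSPORT
(leaf-03-g3's `B13StepOfRecordReadAt` p212254: `readAtSlots S ι`, `transportReads_record_readAt` BY NAME; exactly as its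
`uniform_ne5_of_record_readAt` does for E1).  The binder lists are those of §2 ∕ §3 MINUS `TransportReads`; ONE constant for every
pair of runs `R`, slot package `S` (`S.D.ω = ω`), run-A insertion-operator datum `ι`, window, radii and activity data. -/

section ReadAt

open Summit.QuantumFields.BalabanUV.T4Continuum.B13StepOfRecordReadAt (readAtSlots transportReads_record_readAt)

/-- [folklore] **E8 ON THE CARRIERS OF RECORD, η-UNIFORM, READING DISCHARGED**: §2 at the slot packages `readAtSlots S ι` (run A's
insertion-operator datum read AT `R.carriers.transport U`), `hT := transportReads_record_readAt S ι W` — NO `TransportReads` binder. -/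
theorem uniform_ne5_of_record_secant_readAt {κ Λop G₁ EA₀ E₀ cA cB c₁ r₀ δ' θ θ' ω ρ₀ : ℝ}
    (hEA₀ : 0 ≤ EA₀) (hE₀ : 0 ≤ E₀) (hΛop : 0 ≤ Λop) (hG₁ : 0 ≤ G₁) (hcA : 0 ≤ cA) (hcB : 0 ≤ cB) (hc₁ : 0 ≤ c₁) (hr₀ : 0 < r₀)
    (hδ' : 0 ≤ δ') (hθ0 : 0 < θ) (hθ1 : θ < 1) (hθθ' : θ ≤ θ') (hθ'1 : θ' ≤ 1) (hω : 0 < ω) (hω1 : ω < 1) (hρ₀ : 0 < ρ₀)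
    (hsmall : ω + 2 * G₁ * cA < θ') :
    ∃ C₅ : ℝ, ∀ {𝔾 : Type} [GaugeGroup 𝔾] {R : TwoRuns 𝔾} {E IOp Hist Ω : Type*} [NormedAddCommGroup Hist] [NormedSpace ℂ Hist]
      [MeasurableSpace Ω] (S : Slots R E IOp Hist) (ι : (ℕ → ℝ) → R.carriers.BgA → ℕ → IOp) {W : Set (ℕ → ℝ)} {ROp RHist : ℕ → ℝ}
      {N A : ℕ → (ℕ → ℝ) → R.carriers.BgB → R.carriers.Dom → InnerLabel R.carriers.Dom (Bnd R) → ℝ}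
      {Dt : ActData R.carriers.Dom (InnerLabel R.carriers.Dom (Bnd R)) (OpDatum E) Hist Ω},
      S.D.ω = ω →
      (assembly (readAtSlots S ι)).SliceBudgetB W κ cB →
      (readAtSlots S ι).D.SliceBudget (step (readAtSlots S ι) E₀ cB) W κ cA →
      DecayBound (outA (readAtSlots S ι) E₀ cB) W EA₀ κ → DecayBound (outB (readAtSlots S ι) E₀ cB) W E₀ κ →
      RawBounded S.F (assembly (readAtSlots S ι)).rawAt W → RawBounded S.F S.rawB W →
      WeightedEntrywiseRate S.F (assembly (readAtSlots S ι)).rawAt S.rawB W c₁ (fun k => θ ^ k) → (∀ k, r₀ ≤ S.rOp k) →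
      (step (readAtSlots S ι) E₀ cB).InsertionRate W κ E₀ δ' θ →
      OpLipschitz (step (readAtSlots S ι) E₀ cB) W κ Λop ρ₀ →
      ActExpLinearOn (assembly S).𝒯 S.act Dt
        (ballClass (selfCtr (assembly (readAtSlots S ι)).raw (assembly (readAtSlots S ι)).histRef) ROp RHist) W →
      ActExpNormBound (assembly S).𝒯 Dt
        (ballClass (selfCtr (assembly (readAtSlots S ι)).raw (assembly (readAtSlots S ι)).histRef) ROp RHist) W S.rHist N →
      (∀ k g U Z j, 0 ≤ N k g U Z j) →
      ActAbsBound (assembly S).𝒯 Dt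
        (ballClass (selfCtr (assembly (readAtSlots S ι)).raw (assembly (readAtSlots S ι)).histRef) ROp RHist) W A →
      (∀ k, ∀ g ∈ W, ∀ (U : R.carriers.BgB) (X : R.carriers.Dom), R.carriers.scale X = k →
        Summable (actMajorant (assembly S).𝒯 (assembly S).inc (A k g U) k X)) →
      (∀ k, ∀ g ∈ W, ∀ (U : R.carriers.BgB) (X : R.carriers.Dom), R.carriers.scale X = k →
        Summable (secMajorant (assembly S).𝒯 (assembly S).inc (N k g U) (A k g U) k X) ∧
          ∑' i, secMajorant (assembly S).𝒯 (assembly S).inc (N k g U) (A k g U) k X i ≤ G₁ * Real.exp (-(κ * R.carriers.d X))) →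
      (∀ k, c₁ / r₀ * S.rOp k ≤ ROp k) → (∀ k, (assembly S).bHist E₀ cB k ≤ RHist k) →
      (∀ k, δ' * S.rHist k + EA₀ * (S.rHist k * (cA / (1 - S.D.ω))) ≤ RHist k) →
      NE5 (outA (readAtSlots S ι) E₀ cB) (outB (readAtSlots S ι) E₀ cB) W κ θ' C₅ := by
  obtain ⟨C₅, h⟩ := uniform_ne5_of_record_secant (κ := κ) hEA₀ hE₀ hΛop hG₁ hcA hcB hc₁ hr₀ hδ' hθ0 hθ1 hθθ' hθ'1 hω hω1 hρ₀
    hsmall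
  exact ⟨C₅, fun S ι _ _ _ _ _ _ hSω hbB hbA hdA hdB hRA hRB hwer hfl hins hopL hexp hN hN0 habs hconv hmom hOp hHist hHistA =>
    h (readAtSlots S ι) hSω (transportReads_record_readAt S ι _) hbB hbA hdA hdB hRA hRB hwer hfl hins hopL hexp hN hN0 habs hconv
      hmom hOp hHist hHistA⟩

/-- [folklore] **E8[rec] (HISTORY HALF AT ACTIVITY LEVEL), η-UNIFORM, READING DISCHARGED**: §3 at the slot packages
`readAtSlots S ι`, `hT := transportReads_record_readAt S ι W` — NO `TransportReads` binder. -/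
theorem uniform_ne5_of_record_secant_actNormDecay_readAt {κ Λop Nbar Φ' EA₀ E₀ cA cB c₁ r₀ δ' θ θ' ω ρ₀ : ℝ}
    (hκ : 0 ≤ κ) (hEA₀ : 0 ≤ EA₀) (hE₀ : 0 ≤ E₀) (hΛop : 0 ≤ Λop) (hNbar : 0 ≤ Nbar) (hΦ0 : 0 ≤ Φ') (hΦsmall : 36 * Φ' < 1)
    (hcA : 0 ≤ cA) (hcB : 0 ≤ cB) (hc₁ : 0 ≤ c₁) (hr₀ : 0 < r₀) (hδ' : 0 ≤ δ') (hθ0 : 0 < θ) (hθ1 : θ < 1) (hθθ' : θ ≤ θ')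
    (hθ'1 : θ' ≤ 1) (hω : 0 < ω) (hω1 : ω < 1) (hρ₀ : 0 < ρ₀)
    (hsmall : ω + 2 * (Nbar * (Φ' / (1 - 36 * Φ') ^ 2)) * cA < θ') :
    ∃ C₅ : ℝ, ∀ {𝔾 : Type} [GaugeGroup 𝔾] {R : TwoRuns 𝔾} {E IOp Hist Ω : Type*} [NormedAddCommGroup Hist] [NormedSpace ℂ Hist]
      [MeasurableSpace Ω] (S : Slots R E IOp Hist) (ι : (ℕ → ℝ) → R.carriers.BgA → ℕ → IOp) {W : Set (ℕ → ℝ)} {ROp RHist : ℕ → ℝ}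
      {N A A' : ℕ → (ℕ → ℝ) → R.carriers.BgB → R.carriers.Dom → InnerLabel R.carriers.Dom (Bnd R) → ℝ}
      {Dt : ActData R.carriers.Dom (InnerLabel R.carriers.Dom (Bnd R)) (OpDatum E) Hist Ω},
      S.D.ω = ω →
      (assembly (readAtSlots S ι)).SliceBudgetB W κ cB →
      (readAtSlots S ι).D.SliceBudget (step (readAtSlots S ι) E₀ cB) W κ cA →
      DecayBound (outA (readAtSlots S ι) E₀ cB) W EA₀ κ → DecayBound (outB (readAtSlots S ι) E₀ cB) W E₀ κ →
      RawBounded S.F (assembly (readAtSlots S ι)).rawAt W → RawBounded S.F S.rawB W →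
      WeightedEntrywiseRate S.F (assembly (readAtSlots S ι)).rawAt S.rawB W c₁ (fun k => θ ^ k) → (∀ k, r₀ ≤ S.rOp k) →
      (step (readAtSlots S ι) E₀ cB).InsertionRate W κ E₀ δ' θ →
      OpLipschitz (step (readAtSlots S ι) E₀ cB) W κ Λop ρ₀ →
      ActExpLinearOn (labelsIndexing (domainGeometry R) (b13InnerData R)) S.act Dt
        (ballClass (selfCtr (assembly (readAtSlots S ι)).raw (assembly (readAtSlots S ι)).histRef) ROp RHist) W →
      ActExpNormBound (labelsIndexing (domainGeometry R) (b13InnerData R)) Dt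
        (ballClass (selfCtr (assembly (readAtSlots S ι)).raw (assembly (readAtSlots S ι)).histRef) ROp RHist) W S.rHist N →
      (∀ k g U Z ℓ, 0 ≤ N k g U Z ℓ) → (∀ k g U Z ℓ, N k g U Z ℓ ≤ Nbar) →
      ActAbsBound (labelsIndexing (domainGeometry R) (b13InnerData R)) Dt
        (ballClass (selfCtr (assembly (readAtSlots S ι)).raw (assembly (readAtSlots S ι)).histRef) ROp RHist) W A →
      (∀ k g U Z ℓ, 0 ≤ A k g U Z ℓ) → (∀ k g U Z ℓ, 0 ≤ A' k g U Z ℓ) →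
      (∀ k g U Z ℓ, A k g U Z ℓ ≤ A' k g U Z ℓ * Real.exp (-(κ * (R.carriers.d Z + 5)))) →
      (∀ k, ∀ g ∈ W, ∀ (U : R.carriers.BgB) (q : SCube R),
        ∑ Z ∈ R.domAt k, ind (q ∈ footprint Z) * polyWeight (b13InnerData R) (A' k g U) k Z *
          Real.exp ((footprint Z).card) ≤ Φ') →
      (∀ k, c₁ / r₀ * S.rOp k ≤ ROp k) → (∀ k, (assembly S).bHist E₀ cB k ≤ RHist k) →
      (∀ k, δ' * S.rHist k + EA₀ * (S.rHist k * (cA / (1 - S.D.ω))) ≤ RHist k) →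
      NE5 (outA (readAtSlots S ι) E₀ cB) (outB (readAtSlots S ι) E₀ cB) W κ θ' C₅ := by
  obtain ⟨C₅, h⟩ := uniform_ne5_of_record_secant_actNormDecay (κ := κ) hκ hEA₀ hE₀ hΛop hNbar hΦ0 hΦsmall hcA hcB hc₁ hr₀ hδ'
    hθ0 hθ1 hθθ' hθ'1 hω hω1 hρ₀ hsmall
  exact ⟨C₅, fun S ι _ _ _ _ _ _ _ hSω hbB hbA hdA hdB hRA hRB hwer hfl hins hopL hexp hN hN0 hNle habs hA0 hA0' hdec hΦ hOp hHist
      hHistA =>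
    h (readAtSlots S ι) hSω (transportReads_record_readAt S ι _) hbB hbA hdA hdB hRA hRB hwer hfl hins hopL hexp hN hN0 hNle habs
      hA0 hA0' hdec hΦ hOp hHist hHistA⟩

end ReadAt

end Summit.QuantumFields.BalabanUV.T4Continuum.B13StepSecantArithmetic

end
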